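import Literature.Analysis.OperatorTheory.PositiveKernelSpectralTraceTwo
import HarnessLib

/-!
# Spectral trace formula for two bond insertions separated by a single bond

Continuation of `PositiveKernelSpectralTrace.lean` / `PositiveKernelSpectralTraceTwo.lean` (same setting: a
bounded symmetric strongly measurable kernel `K` on a finite measure space, its `L²` transfer operator `A`, a
countable Hilbert basis of eigenvectors `A bᵢ = λᵢ bᵢ`, and two further bounded kernels `X, X'` with `L²`
operators `𝒳, 𝒳'`).  `hasSum_integral_iterate_insert_two` there gives the double spectral sum for the nested
integral of `HeterogeneousCyclicPeeling.integral_cyclic_insert_two` when the two insertions are separated by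
`a + 2 ≥ 2` bonds of `K`.  This file proves the gap-`(a+1)` variant

  `∫∫ X(x,y) (κ^[a+1] (z ↦ ∫ X'(z,w) (κ^[b+1] K(·,x))(w)))(y) dμ(y) dμ(x)
     = Σ_{(i,j)} λⱼ^{a+1} λᵢ^{b+2} ⟪bᵢ, 𝒳 bⱼ⟫ ⟪bⱼ, 𝒳' bᵢ⟫`   (`Tr(𝒳 A^{a+1} 𝒳' A^{b+2})`),

`hasSum_integral_iterate_insert_two_succ`, which also covers ADJACENT insertions (`a = 0`: the two inserted
bonds share a time slice, the geometry of a reflected pair `ΘY · Y` touching the reflection hyperplane).  For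
`a = 0` the matrix `⟪bⱼ, 𝒳' A^{b+1} bᵢ⟫` has no decay in `j`, so instead of the double Parseval expansion of the
original proof we expand only `A^{b+1} k_x = Σᵢ λᵢ^{b+1} (κ bᵢ)(x) bᵢ` (a single, absolutely dominated sum),
integrate termwise twice (dominated convergence), obtain `Σᵢ λᵢ^{b+2} ⟪bᵢ, 𝒳 A^{a+1} 𝒳' bᵢ⟫`, and only then
open the second Parseval sum `⟪bᵢ, 𝒳 A^{a+1} 𝒳' bᵢ⟫ = Σⱼ λⱼ^{a+1} ⟪bᵢ, 𝒳 bⱼ⟫ ⟪bⱼ, 𝒳' bᵢ⟫`, the double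
family being absolutely summable by Bessel's inequality for `𝒳' bᵢ` and `Σ λ² < ∞`.
Mathlib + companions only; no definitions.
References: M. Reed, B. Simon, *Methods of Modern Mathematical Physics I* (1980), Thm. VI.22–VI.23;
B. Simon, *Trace Ideals and Their Applications* (2005), Ch. 3; K. Osterwalder, E. Seiler, *Gauge field
theories on a lattice*, Ann. Phys. 110 (1978), §3 (transfer matrix and reflection positivity). [folklore]
-/

noncomputable section

open MeasureTheory Filter Set Function
open scoped RealInnerProductSpace ENNReal

namespace Literature.Analysis.OperatorTheory

variable {X : Type*} [MeasurableSpace X] {μ : Measure X} [IsFiniteMeasure μ]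
  {K : X → X → ℝ} {C : ℝ} {A : Lp ℝ 2 μ →L[ℝ] Lp ℝ 2 μ} {ι : Type*}
  {b : HilbertBasis ι ℝ (Lp ℝ 2 μ)} {lam : ι → ℝ}

/-- **Two bond insertions separated by `a + 1 ≥ 1` bonds.**  For two further bounded kernels `X, X'` with `L²`
operators `𝒳, 𝒳'`, the nested integral produced by `integral_cyclic_insert_two` (first gap `a + 1`) is the
double spectral sum
`∫∫ X(x,y) (κ^[a+1] (z ↦ ∫ X'(z,w) (κ^[b+1] K(·,x))(w)))(y) dμ(y) dμ(x)
   = Σ_{(i,j)} λⱼ^{a+1} λᵢ^{b+2} ⟪bᵢ, 𝒳 bⱼ⟫ ⟪bⱼ, 𝒳' bᵢ⟫`  (`Tr(𝒳 A^{a+1} 𝒳' A^{b+2})`); the gap-`(a+1)` variant of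
`hasSum_integral_iterate_insert_two`, covering adjacent insertions (`a = 0`). [folklore] -/
theorem hasSum_integral_iterate_insert_two_succ [Countable ι] (hK : StronglyMeasurable (uncurry K))
    (hC : ∀ x y, ‖K x y‖ ≤ C) (hsymm : ∀ x y, K x y = K y x)
    (hA : ∀ φ : Lp ℝ 2 μ, (A φ : X → ℝ) =ᵐ[μ] fun x => ∫ y, K x y * φ y ∂μ)
    (hb : ∀ i, A (b i) = lam i • b i) {Xk : X → X → ℝ} {CX : ℝ} (hX : StronglyMeasurable (uncurry Xk))
    (hCX : ∀ x y, ‖Xk x y‖ ≤ CX) {Xop : Lp ℝ 2 μ →L[ℝ] Lp ℝ 2 μ}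
    (hXop : ∀ φ : Lp ℝ 2 μ, (Xop φ : X → ℝ) =ᵐ[μ] fun x => ∫ y, Xk x y * φ y ∂μ)
    {Xk' : X → X → ℝ} {CX' : ℝ} (hX' : StronglyMeasurable (uncurry Xk')) (hCX' : ∀ x y, ‖Xk' x y‖ ≤ CX')
    {Xop' : Lp ℝ 2 μ →L[ℝ] Lp ℝ 2 μ} (hXop' : ∀ φ : Lp ℝ 2 μ, (Xop' φ : X → ℝ) =ᵐ[μ] fun x => ∫ y, Xk' x y * φ y ∂μ)
    (a b' : ℕ) :
    HasSum (fun p : ι × ι => lam p.2 ^ (a + 1) * lam p.1 ^ (b' + 2) * ⟪b p.1, Xop (b p.2)⟫ * ⟪b p.2, Xop' (b p.1)⟫)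
      (∫ x, ∫ y, Xk x y * ((fun f : X → ℝ => fun w => ∫ z, K w z * f z ∂μ)^[a + 1]
        (fun z => ∫ w, Xk' z w * ((fun f : X → ℝ => fun w => ∫ z, K w z * f z ∂μ)^[b' + 1] (fun v => K v x)) w ∂μ))
          y ∂μ ∂μ) := by
  -- notation: `κ` the pointwise operator, `c i = κ bᵢ`, `kx x = k_x` the sections, `v i = A^a 𝒳' bᵢ`,
  -- `e i = κ (v i)` (an honest representative of `A^{a+1} 𝒳' bᵢ`), `q i x = ∫ X(x,y) e i y`
  set κ : (X → ℝ) → X → ℝ := fun f w => ∫ z, K w z * f z ∂μ with hκ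
  set c : ι → X → ℝ := fun i x => ∫ z, K x z * b i z ∂μ with hc
  set kx : X → Lp ℝ 2 μ := fun x => (memLp_kernel_section (μ := μ) hK hC x).toLp (K x) with hkx
  set v : ι → Lp ℝ 2 μ := fun i => (A ^ a) (Xop' (b i)) with hv
  set e : ι → X → ℝ := fun i y => ∫ z, K y z * v i z ∂μ with he
  set q : ι → X → ℝ := fun i x => ∫ y, Xk x y * e i y ∂μ with hq
  set T : Lp ℝ 2 μ →L[ℝ] Lp ℝ 2 μ := (A ^ a).comp (Xop'.comp (A ^ (b' + 1))) with hT
  have hcm : ∀ i, Measurable (c i) := fun i => measurable_integral_kernel_mul_basis hK b i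
  have hem : ∀ i, Measurable (e i) := fun i => (stronglyMeasurable_integral_kernel_mul hK (v i)).measurable
  have hqm : ∀ i, Measurable (q i) := fun i => measurable_integral_kernel_mul_fun hX (hem i)
  have hlamA : ∀ i, |lam i| ≤ ‖A‖ := abs_lam_le_norm hb
  have hpars : ∀ x, Summable (fun i => c i x ^ 2) ∧ ∑' i, c i x ^ 2 ≤ C ^ 2 * μ.real univ :=
    fun x => tsum_sq_integral_kernel_mul_le hK hC b x
  have hsq_meas : Measurable fun x => ∫ z, ‖K x z‖ ^ 2 ∂μ := (stronglyMeasurable_integral_norm_kernel_sq hK).measurable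
  have hsq_eq : ∀ x, ∑' i, c i x ^ 2 = ∫ z, ‖K x z‖ ^ 2 ∂μ := fun x =>
    (hasSum_norm_sq_integral_kernel_mul (𝕜 := ℝ) hK hC b x |>.tsum_eq |> fun h => by
      simpa only [Real.norm_eq_abs, sq_abs] using h)
  have hlam2 : Summable fun i => lam i ^ 2 := (hasSum_lam_sq hK hC hA hb).summable
  have hae : ∀ i, (A (b i) : X → ℝ) =ᵐ[μ] c i := fun i => hA (b i)
  have hcoef : ∀ x i, ⟪b i, kx x⟫ = c i x := fun x i => by
    rw [real_inner_comm]; exact inner_kernel_section_basis hK hC b x i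
  have hsa : ∀ j : ℕ, IsSelfAdjoint (A ^ j) := fun j => (isSelfAdjoint_kernelOp hK hC hsymm hA).pow j
  -- sizes of `v i`, `e i`, `q i`
  have hvn : ∀ i, ‖v i‖ ≤ ‖A ^ a‖ * ‖Xop'‖ := fun i => by
    calc ‖(A ^ a) (Xop' (b i))‖ ≤ ‖A ^ a‖ * ‖Xop' (b i)‖ := (A ^ a).le_opNorm _
      _ ≤ ‖A ^ a‖ * (‖Xop'‖ * ‖b i‖) := mul_le_mul_of_nonneg_left (Xop'.le_opNorm _) (norm_nonneg _)
      _ = ‖A ^ a‖ * ‖Xop'‖ := by rw [b.orthonormal.norm_eq_one, mul_one]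
  have heb : ∀ i y, |e i y| ≤ C * Real.sqrt (μ.real univ) * (‖A ^ a‖ * ‖Xop'‖) := fun i y => by
    have hC0 : 0 ≤ C := (norm_nonneg _).trans (hC y y)
    refine (abs_integral_kernel_mul_le hC hC0 (v i) y).trans ?_
    exact mul_le_mul_of_nonneg_left (hvn i) (by positivity)
  have he_ae : ∀ i, (A (v i) : X → ℝ) =ᵐ[μ] e i := fun i => hA (v i)
  have hq_eq : ∀ i x, q i x = ∫ y, Xk x y * (A (v i)) y ∂μ := fun i x =>
    integral_congr_ae (by filter_upwards [he_ae i] with y hy; rw [hy])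
  have hqb : ∀ i x, |q i x| ≤ CX * Real.sqrt (μ.real univ) * (‖A‖ * (‖A ^ a‖ * ‖Xop'‖)) := fun i x => by
    have hCX0 : 0 ≤ CX := (norm_nonneg _).trans (hCX x x)
    rw [hq_eq]
    refine (abs_integral_kernel_mul_le hCX hCX0 (A (v i)) x).trans ?_
    exact mul_le_mul_of_nonneg_left ((A.le_opNorm _).trans
      (mul_le_mul_of_nonneg_left (hvn i) (norm_nonneg _))) (by positivity)
  -- (A) the nested inner function is an inner product of sections: `(κ^[a+1] F_x)(y) = ⟪k_y, T k_x⟫`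
  have hstepA : ∀ x y, (κ^[a + 1] (fun z => ∫ w, Xk' z w * (κ^[b' + 1] (fun v => K v x)) w ∂μ)) y =
      ⟪kx y, T (kx x)⟫ := by
    intro x y
    have hKx : (fun v => K v x) = K x := funext fun v => hsymm v x
    have hKxm : Measurable (K x) := hK.measurable.of_uncurry_left
    obtain ⟨⟨B, hB⟩, hGm⟩ := exists_bound_and_measurable_kernelIterate (μ := μ) hK hC hKxm ⟨C, fun v => hC x v⟩
      (b' + 1)
    rw [hKx]
    set G : X → ℝ := κ^[b' + 1] (K x) with hG
    set F : X → ℝ := fun z => ∫ w, Xk' z w * G w ∂μ with hF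
    have hFm : Measurable F := measurable_integral_kernel_mul_fun hX' hGm.measurable
    have hFb : ∀ z, ‖F z‖ ≤ CX' * (B * μ.real univ) := fun z => by
      calc ‖∫ w, Xk' z w * G w ∂μ‖ ≤ ∫ w, ‖Xk' z w * G w‖ ∂μ := norm_integral_le_integral_norm _
        _ ≤ ∫ _w, CX' * B ∂μ := by
            refine integral_mono_of_nonneg (Eventually.of_forall fun w => norm_nonneg _)
              (integrable_const _) (Eventually.of_forall fun w => ?_)
            dsimp only
            rw [norm_mul]
            exact mul_le_mul (hCX' z w) (hB w) (norm_nonneg _) ((norm_nonneg _).trans (hCX' z w))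
        _ = CX' * (B * μ.real univ) := by rw [integral_const, smul_eq_mul]; ring
    -- the class of `G` is `A^{b'+1} k_x`, the class of `F` is `𝒳' (A^{b'+1} k_x)`
    have hGcl : ((A ^ (b' + 1)) (kx x) : X → ℝ) =ᵐ[μ] G :=
      pow_kernelOp_toLp_ae_eq_iterate (μ := μ) hA hKxm (fun v => hC x v) (b' + 1)
    have hFcl : (memLp_two_of_bound (μ := μ) hFm hFb).toLp F = Xop' ((A ^ (b' + 1)) (kx x)) := by
      refine Lp.ext ((MemLp.coeFn_toLp _).trans (EventuallyEq.trans (Eventually.of_forall fun z => ?_)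
        (hXop' _).symm))
      exact integral_congr_ae (by filter_upwards [hGcl] with w hw; rw [hw])
    have h1 := inner_kernel_section_pow_kernelOp hK hC hsymm hA hFm hFb a y
    rw [hFcl] at h1
    rw [← h1]
    simp only [hkx, hT, ContinuousLinearMap.comp_apply]
  -- (B) the single expansion `⟪k_y, T k_x⟫ = Σᵢ λᵢ^{b'+1} cᵢ(x) eᵢ(y)` (expand `A^{b'+1} k_x`, apply `A^a 𝒳'`)
  have hbi : ∀ x i, ⟪b i, (A ^ (b' + 1)) (kx x)⟫ = lam i ^ (b' + 1) * c i x := fun x i => by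
    rw [← (hsa (b' + 1)).adjoint_eq, ContinuousLinearMap.adjoint_inner_right, pow_apply_basis hb,
      real_inner_smul_left, hcoef]
  have hev : ∀ i y, ⟪kx y, v i⟫ = e i y := fun i y => by
    rw [real_inner_comm]
    simp only [hkx]
    rw [inner_kernel_section hK hC]
    exact integral_congr_ae (Eventually.of_forall fun z => mul_comm _ _)
  have hexp : ∀ x y, HasSum (fun i => lam i ^ (b' + 1) * c i x * e i y) ⟪kx y, T (kx x)⟫ := by
    intro x y
    have h0 : HasSum (fun i => ⟪b i, (A ^ (b' + 1)) (kx x)⟫ • b i) ((A ^ (b' + 1)) (kx x)) := by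
      simpa only [HilbertBasis.repr_apply_apply] using b.hasSum_repr ((A ^ (b' + 1)) (kx x))
    have h1 := (h0.mapL ((A ^ a).comp Xop')).mapL (innerSL ℝ (kx y))
    simp only [map_smul, ContinuousLinearMap.comp_apply, innerSL_apply_apply, smul_eq_mul] at h1
    have h2 : HasSum (fun i => ⟪b i, (A ^ (b' + 1)) (kx x)⟫ * ⟪kx y, v i⟫) ⟪kx y, T (kx x)⟫ := by
      simpa only [hT, ContinuousLinearMap.comp_apply] using h1
    refine h2.congr_fun fun i => ?_
    rw [hbi, hev]
  -- (C) level one: for each `x`, the `y`-integral commutes with the sum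
  have hlev1 : ∀ x, HasSum (fun i => lam i ^ (b' + 1) * c i x * q i x)
      (∫ y, Xk x y * (κ^[a + 1] (fun z => ∫ w, Xk' z w * (κ^[b' + 1] (fun v => K v x)) w ∂μ)) y ∂μ) := by
    intro x
    have hCX0 : 0 ≤ CX := (norm_nonneg _).trans (hCX x x)
    have hC0 : 0 ≤ C := (norm_nonneg _).trans (hC x x)
    have key := hasSum_integral_of_dominated_convergence (μ := μ)
      (F := fun i y => Xk x y * (lam i ^ (b' + 1) * c i x * e i y))
      (f := fun y => Xk x y * (κ^[a + 1] (fun z => ∫ w, Xk' z w * (κ^[b' + 1] (fun v => K v x)) w ∂μ)) y)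
      (fun i _ => CX * (C * Real.sqrt (μ.real univ) * (‖A ^ a‖ * ‖Xop'‖)) * ‖A‖ ^ b' *
        ((c i x ^ 2 + lam i ^ 2) / 2))
      (fun i => ?_) (fun i => ?_) ?_ ?_
      (Eventually.of_forall fun y => by rw [hstepA x y]; exact (hexp x y).mul_left _)
    · refine key.congr_fun fun i => ?_
      simp only [hq]
      rw [← integral_const_mul]
      refine integral_congr_ae (Eventually.of_forall fun y => ?_)
      ring
    · exact ((hX.measurable.of_uncurry_left).mul ((hem i).const_mul _)).aestronglyMeasurable
    · refine Eventually.of_forall fun y => ?_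
      rw [norm_mul, norm_mul, norm_mul, Real.norm_eq_abs, Real.norm_eq_abs, Real.norm_eq_abs, Real.norm_eq_abs,
        abs_pow]
      have h1 : |Xk x y| ≤ CX := by simpa [Real.norm_eq_abs] using hCX x y
      have h2 : |lam i| ^ (b' + 1) ≤ ‖A‖ ^ b' * |lam i| := by
        rw [pow_succ]; exact mul_le_mul_of_nonneg_right (pow_le_pow_left₀ (abs_nonneg _) (hlamA _) b') (abs_nonneg _)
      have h3 : |c i x| * |lam i| ≤ (c i x ^ 2 + lam i ^ 2) / 2 := by
        have hsq := two_mul_le_add_sq |c i x| |lam i|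
        rw [sq_abs, sq_abs] at hsq
        linarith
      have h4 := heb i y
      calc |Xk x y| * (|lam i| ^ (b' + 1) * |c i x| * |e i y|)
          ≤ CX * (‖A‖ ^ b' * |lam i| * |c i x| * (C * Real.sqrt (μ.real univ) * (‖A ^ a‖ * ‖Xop'‖))) := by
            gcongr
        _ = CX * (C * Real.sqrt (μ.real univ) * (‖A ^ a‖ * ‖Xop'‖)) * ‖A‖ ^ b' * (|c i x| * |lam i|) := by ring
        _ ≤ CX * (C * Real.sqrt (μ.real univ) * (‖A ^ a‖ * ‖Xop'‖)) * ‖A‖ ^ b' * ((c i x ^ 2 + lam i ^ 2) / 2) := by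
            gcongr
    · exact Eventually.of_forall fun y => (((hpars x).1.add hlam2).div_const 2).mul_left _
    · exact integrable_const _
  -- (D) the terms of level two: `∫ λᵢ^{b'+1} cᵢ qᵢ = λᵢ^{b'+2} ⟪bᵢ, 𝒳 A^{a+1} 𝒳' bᵢ⟫`
  have hterm : ∀ i, ∫ x, lam i ^ (b' + 1) * c i x * q i x ∂μ = lam i ^ (b' + 2) * ⟪b i, Xop (A (v i))⟫ := by
    intro i
    have h1 : ∫ x, c i x * q i x ∂μ = ⟪A (b i), Xop (A (v i))⟫ := by
      rw [inner_kernelOp_eq_integral hXop]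
      refine integral_congr_ae ?_
      filter_upwards [hae i] with x hx
      rw [hx, hq_eq i x]
    calc ∫ x, lam i ^ (b' + 1) * c i x * q i x ∂μ = lam i ^ (b' + 1) * ∫ x, c i x * q i x ∂μ := by
          rw [← integral_const_mul]
          exact integral_congr_ae (Eventually.of_forall fun x => by ring)
      _ = lam i ^ (b' + 2) * ⟪b i, Xop (A (v i))⟫ := by
          rw [h1, hb, real_inner_smul_left]
          ring
  -- (E) level two: the `x`-integral commutes with the sum
  have hlev2 : HasSum (fun i => ∫ x, lam i ^ (b' + 1) * c i x * q i x ∂μ)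
      (∫ x, ∫ y, Xk x y * (κ^[a + 1] (fun z => ∫ w, Xk' z w * (κ^[b' + 1] (fun v => K v x)) w ∂μ)) y ∂μ ∂μ) := by
    refine hasSum_integral_of_dominated_convergence (μ := μ)
      (F := fun i x => lam i ^ (b' + 1) * c i x * q i x)
      (fun i x => CX * Real.sqrt (μ.real univ) * (‖A‖ * (‖A ^ a‖ * ‖Xop'‖)) * ‖A‖ ^ b' *
        ((c i x ^ 2 + lam i ^ 2) / 2))
      (fun i => (((hcm i).const_mul _).mul (hqm i)).aestronglyMeasurable) (fun i => ?_) ?_ ?_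
      (Eventually.of_forall fun x => hlev1 x)
    · refine Eventually.of_forall fun x => ?_
      rw [Real.norm_eq_abs, abs_mul, abs_mul, abs_pow]
      have hCX0 : 0 ≤ CX := (norm_nonneg _).trans (hCX x x)
      have h2 : |lam i| ^ (b' + 1) ≤ ‖A‖ ^ b' * |lam i| := by
        rw [pow_succ]; exact mul_le_mul_of_nonneg_right (pow_le_pow_left₀ (abs_nonneg _) (hlamA _) b') (abs_nonneg _)
      have h3 : |c i x| * |lam i| ≤ (c i x ^ 2 + lam i ^ 2) / 2 := by
        have hsq := two_mul_le_add_sq |c i x| |lam i|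
        rw [sq_abs, sq_abs] at hsq
        linarith
      calc |lam i| ^ (b' + 1) * |c i x| * |q i x|
          ≤ ‖A‖ ^ b' * |lam i| * |c i x| * (CX * Real.sqrt (μ.real univ) * (‖A‖ * (‖A ^ a‖ * ‖Xop'‖))) := by
            gcongr
            exact hqb i x
        _ = CX * Real.sqrt (μ.real univ) * (‖A‖ * (‖A ^ a‖ * ‖Xop'‖)) * ‖A‖ ^ b' * (|c i x| * |lam i|) := by
            ring
        _ ≤ CX * Real.sqrt (μ.real univ) * (‖A‖ * (‖A ^ a‖ * ‖Xop'‖)) * ‖A‖ ^ b' *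
            ((c i x ^ 2 + lam i ^ 2) / 2) := by gcongr
    · exact Eventually.of_forall fun x => (((hpars x).1.add hlam2).div_const 2).mul_left _
    · have hfun : (fun x => ∑' i, CX * Real.sqrt (μ.real univ) * (‖A‖ * (‖A ^ a‖ * ‖Xop'‖)) * ‖A‖ ^ b' *
          ((c i x ^ 2 + lam i ^ 2) / 2)) =
          fun x => CX * Real.sqrt (μ.real univ) * (‖A‖ * (‖A ^ a‖ * ‖Xop'‖)) * ‖A‖ ^ b' *
            ((∫ z, ‖K x z‖ ^ 2 ∂μ + ∑' i, lam i ^ 2) / 2) := by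
        funext x
        rw [tsum_mul_left, tsum_div_const, (hpars x).1.tsum_add hlam2, hsq_eq x]
      rw [hfun]
      exact ((Integrable.of_bound hsq_meas.aestronglyMeasurable (C ^ 2 * μ.real univ)
        (Eventually.of_forall fun y => by
          rw [Real.norm_eq_abs, abs_of_nonneg (integral_nonneg fun z => by positivity), ← hsq_eq y]
          exact (hpars y).2)).add (integrable_const _)).div_const 2 |>.const_mul _
  -- (F) the fibre sums `Σⱼ λⱼ^{a+1} λᵢ^{b'+2} ⟪bᵢ, 𝒳 bⱼ⟫ ⟪bⱼ, 𝒳' bᵢ⟫ = λᵢ^{b'+2} ⟪bᵢ, 𝒳 A^{a+1} 𝒳' bᵢ⟫` (Parseval)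
  have hfib : ∀ i, HasSum (fun j => lam j ^ (a + 1) * lam i ^ (b' + 2) * ⟪b i, Xop (b j)⟫ * ⟪b j, Xop' (b i)⟫)
      (lam i ^ (b' + 2) * ⟪b i, Xop (A (v i))⟫) := by
    intro i
    have hAv : A (v i) = (A ^ (a + 1)) (Xop' (b i)) := by
      simp only [hv]
      rw [pow_succ', mul_apply_eq_comp]
    have hj : ∀ j, ⟪b j, A (v i)⟫ = lam j ^ (a + 1) * ⟪b j, Xop' (b i)⟫ := fun j => by
      rw [hAv, ← (hsa (a + 1)).adjoint_eq, ContinuousLinearMap.adjoint_inner_right, pow_apply_basis hb,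
        real_inner_smul_left]
    have h := (b.hasSum_inner_mul_inner ((ContinuousLinearMap.adjoint Xop) (b i)) (A (v i))).mul_left
      (lam i ^ (b' + 2))
    rw [ContinuousLinearMap.adjoint_inner_left] at h
    refine h.congr_fun fun j => ?_
    rw [ContinuousLinearMap.adjoint_inner_left, hj]
    ring
  -- (G) the double family is absolutely summable (Bessel for `𝒳' bᵢ`, `Σ λ² < ∞`)
  have hbes : ∀ i, Summable fun j => ⟪b j, Xop' (b i)⟫ ^ 2 := fun i => by
    simpa only [Real.norm_eq_abs, sq_abs] using b.orthonormal.inner_products_summable (Xop' (b i))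
  have hbes_le : ∀ i, ∑' j, ⟪b j, Xop' (b i)⟫ ^ 2 ≤ ‖Xop'‖ ^ 2 := fun i => by
    have h := b.orthonormal.tsum_inner_products_le (Xop' (b i))
    simp only [Real.norm_eq_abs, sq_abs] at h
    refine h.trans (pow_le_pow_left₀ (norm_nonneg _) ?_ 2)
    have h' := Xop'.le_opNorm (b i)
    rwa [b.orthonormal.norm_eq_one, mul_one] at h'
  have hsum : Summable
      (fun p : ι × ι => lam p.2 ^ (a + 1) * lam p.1 ^ (b' + 2) * ⟪b p.1, Xop (b p.2)⟫ * ⟪b p.2, Xop' (b p.1)⟫) := by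
    have hbd : ∀ p : ι × ι, |lam p.2 ^ (a + 1) * lam p.1 ^ (b' + 2) * ⟪b p.1, Xop (b p.2)⟫ * ⟪b p.2, Xop' (b p.1)⟫| ≤
        ‖A‖ ^ (a + b') * ‖Xop‖ * (lam p.1 ^ 2 * ((lam p.2 ^ 2 + ⟪b p.2, Xop' (b p.1)⟫ ^ 2) / 2)) := by
      intro p
      rw [abs_mul, abs_mul, abs_mul, abs_pow, abs_pow]
      have h1 : |lam p.2| ^ (a + 1) ≤ ‖A‖ ^ a * |lam p.2| := by
        rw [pow_succ]; exact mul_le_mul_of_nonneg_right (pow_le_pow_left₀ (abs_nonneg _) (hlamA _) a) (abs_nonneg _)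
      have h2 : |lam p.1| ^ (b' + 2) ≤ ‖A‖ ^ b' * lam p.1 ^ 2 := by
        rw [pow_add, ← sq_abs (lam p.1)]
        exact mul_le_mul_of_nonneg_right (pow_le_pow_left₀ (abs_nonneg _) (hlamA _) b') (sq_nonneg _)
      have h3 : |⟪b p.1, Xop (b p.2)⟫| ≤ ‖Xop‖ := by
        calc |⟪b p.1, Xop (b p.2)⟫| ≤ ‖b p.1‖ * ‖Xop (b p.2)‖ := abs_real_inner_le_norm _ _
          _ ≤ 1 * (‖Xop‖ * ‖b p.2‖) := by
              rw [b.orthonormal.norm_eq_one]; exact mul_le_mul_of_nonneg_left (Xop.le_opNorm _) zero_le_one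
          _ = ‖Xop‖ := by rw [b.orthonormal.norm_eq_one, mul_one, one_mul]
      have h4 : |lam p.2| * |⟪b p.2, Xop' (b p.1)⟫| ≤ (lam p.2 ^ 2 + ⟪b p.2, Xop' (b p.1)⟫ ^ 2) / 2 := by
        have hsq := two_mul_le_add_sq |lam p.2| |⟪b p.2, Xop' (b p.1)⟫|
        rw [sq_abs, sq_abs] at hsq
        linarith
      calc |lam p.2| ^ (a + 1) * |lam p.1| ^ (b' + 2) * |⟪b p.1, Xop (b p.2)⟫| * |⟪b p.2, Xop' (b p.1)⟫|
          ≤ ‖A‖ ^ a * |lam p.2| * (‖A‖ ^ b' * lam p.1 ^ 2) * ‖Xop‖ * |⟪b p.2, Xop' (b p.1)⟫| := by gcongr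
        _ = ‖A‖ ^ (a + b') * ‖Xop‖ * (lam p.1 ^ 2 * (|lam p.2| * |⟪b p.2, Xop' (b p.1)⟫|)) := by
            rw [pow_add]; ring
        _ ≤ ‖A‖ ^ (a + b') * ‖Xop‖ * (lam p.1 ^ 2 * ((lam p.2 ^ 2 + ⟪b p.2, Xop' (b p.1)⟫ ^ 2) / 2)) := by
            gcongr
    have hg0 : Summable fun p : ι × ι => lam p.1 ^ 2 * ((lam p.2 ^ 2 + ⟪b p.2, Xop' (b p.1)⟫ ^ 2) / 2) := by
      have hnn : ∀ p : ι × ι, 0 ≤ lam p.1 ^ 2 * ((lam p.2 ^ 2 + ⟪b p.2, Xop' (b p.1)⟫ ^ 2) / 2) :=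
        fun p => by positivity
      refine (summable_prod_of_nonneg hnn).2 ⟨fun i => ?_, ?_⟩
      · show Summable fun j => lam i ^ 2 * ((lam j ^ 2 + ⟪b j, Xop' (b i)⟫ ^ 2) / 2)
        exact ((hlam2.add (hbes i)).div_const 2).mul_left _
      · show Summable fun i => ∑' j, lam i ^ 2 * ((lam j ^ 2 + ⟪b j, Xop' (b i)⟫ ^ 2) / 2)
        have hrow : ∀ i, ∑' j, lam i ^ 2 * ((lam j ^ 2 + ⟪b j, Xop' (b i)⟫ ^ 2) / 2) =
            lam i ^ 2 * (((∑' j, lam j ^ 2) + ∑' j, ⟪b j, Xop' (b i)⟫ ^ 2) / 2) := fun i => by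
          rw [tsum_mul_left, tsum_div_const, hlam2.tsum_add (hbes i)]
        simp only [hrow]
        refine (hlam2.mul_right (((∑' j, lam j ^ 2) + ‖Xop'‖ ^ 2) / 2)).of_nonneg_of_le
          (fun i => by positivity) (fun i => ?_)
        have h := hbes_le i
        gcongr
    have hg : Summable fun p : ι × ι =>
        ‖A‖ ^ (a + b') * ‖Xop‖ * (lam p.1 ^ 2 * ((lam p.2 ^ 2 + ⟪b p.2, Xop' (b p.1)⟫ ^ 2) / 2)) :=
      hg0.mul_left _
    exact Summable.of_norm_bounded hg (fun p => by rw [Real.norm_eq_abs]; exact hbd p)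
  -- (H) assemble: the fibrewise sums of the double family have the value of the nested integral
  have h3 : HasSum (fun i => lam i ^ (b' + 2) * ⟪b i, Xop (A (v i))⟫)
      (∫ x, ∫ y, Xk x y * (κ^[a + 1] (fun z => ∫ w, Xk' z w * (κ^[b' + 1] (fun v => K v x)) w ∂μ)) y ∂μ ∂μ) := by
    simpa only [hterm] using hlev2
  obtain ⟨S, hS⟩ := hsum
  have hS' := hS.prod_fiberwise hfib
  rwa [← h3.unique hS'] at hS

end Literature.Analysis.OperatorTheory

end
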